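import Summits.BirchSwinnertonDyer.BirchSwinnertonDyer.Theorems.TwoAdicConverseBDPSelmerLowerDivisibilityAtTwoLineLift
import Literature.NumberTheory.EllipticCurves.TwoVariableSelmerDual
import Literature.NumberTheory.EllipticCurves.YanZhu2026.GreenbergMainTheorems
import HarnessLib

/-!
# The LINE LIFT over `Λ₂`, II: residual non-vanishing of a characteristic generator and the instantiation at
# `X_Gr(E/K̃_∞)` — the torsion conjunct of O2 / R0T and the `μ = 0` conjunct of Rres from ONE line (crux
# `BDPSelmerLowerDivisibilityAtTwo`, stmt-BirchSwinnertonDyer-24728; route `TwoAdicConverse`, rung S3)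

Helper file `--supports stmt-BirchSwinnertonDyer-24728` (seat `bsd-2adic-tower-1` GEN 45), companion of
`…TwoAdicConverseBDPSelmerLowerDivisibilityAtTwoLineLift.lean` (same namespace; see its docstring for the LEMMA and
its proof). THEOREMS ONLY (no definition, no named fact, no instance, no `sorry`); any prime `p`.

* §4 (the INPUT from one line, `ℤ_p`-currency) `finite_quotient_sup_smul_top` (iterated layers),
  `finite_quotient_span_p_smul_top_of_moduleFinite_padicInt` (`N` finitely generated over `ℤ_p` ⇒ `N/pN` finite),
  `finite_quotient_p_CX_of_moduleFinite_padicInt` / `…_p_X_…` — **`M/T₂M` finitely generated over `ℤ_p` ⇒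
  `M/(p, T₂)M` finite** (the tree's one-variable currency `μ = 0 ⟺ finitely generated over ℤ_p`,
  `IwasawaAlgebra.muInvariant_eq_zero_iff`, read on the line module); hence `isTorsion_of_moduleFinite_padicInt_quotient_CX`,
  `lengthAt_span_p_eq_zero_of_moduleFinite_padicInt_quotient_CX`: TORSION and `μ₂ = 0` of `M` from
  «`M` finitely generated over `Λ₂` ∧ `M/T₂M` finitely generated over `ℤ_p`».
* §5 `exists_isUnit_coeff_of_not_dvd`, `map_residue_toUnr₂_ne_zero_of_not_dvd` — `p ∤ C₀` in `Λ₂` ⇒ some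
  coefficient of `C₀` is a unit ⇒ `red(toUnr₂ J C₀) ≠ 0` in `𝔽̄_p⟦T₁⟧⟦T₂⟧` for EVERY ring map `J : ℤ_p → 𝒪_{ℂ_p}`
  (`IwasawaAlgebra₂.toUnr₂`, the coefficient map of the O2 frame; `red = PowerSeries.map (PowerSeries.map residue)`
  = the line files' `red₂`); `not_dvd_of_charIdeal_eq_span_of_finite_quotient_p_CX/_p_X` and
  `map_residue_toUnr₂_ne_zero_of_charIdeal_eq_span_of_finite_quotient_p_CX/_p_X` — for a finitely generated
  `Λ₂`-module with finite double layer `M/(p, T₂)M` (resp. `M/(p, T₁)M`), every generator of `ch_{Λ₂}(M)` is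
  prime to `p` and residually non-zero along every `J`.
* §6 `xGr₂_isTorsion_of_finite_quotient_p_CX/_p_X`, `xGr₂_map_residue_toUnr₂_ne_zero_of_finite_quotient_p_CX`
  (+ the `ℤ_p`-currency forms `…_of_moduleFinite_padicInt_quotient_CX`) —
  the same AT `M = X_Gr(E/K̃_∞) = WeierstrassCurve.XGr₂ W p κ₁ κ₂ v̄ γ₁ γ₂` (any number field `K`, any curve, any
  pair of `ℤ_p`-extensions with topological generators): «`X_Gr` finitely generated over `Λ_K` with finite double
  layer ⇒ `X_Gr` is `Λ_K`-torsion and `red(toUnr₂ J C₀) ≠ 0` for `ch_{Λ_K}(X_Gr) = (C₀)`» — the torsion conjunct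
  of `TwoVariableGvSqueezeTwo.GreenbergFrameTorsionAt` (R0T) and the first conjunct of
  `TwoVariableGvSqueezeTwo.GreenbergResidualEqualityForallAt` (Rres) of the line `two_variable_gv_squeeze_two`,
  and the TORSION / `μ(X_Gr) = 0` clauses the line `special_fibre_square_two` expects from RES2, each reduced to
  finite generation + ONE finite double layer (= torsion + `μ = 0` on one ℤ_p-line after control).

Nothing about any elliptic curve is asserted beyond these implications (finite generation of `X_Gr` and the finite
double layer are HYPOTHESES); O2 and its research stubs stay OPEN; BSD is proved for no curve. References:
[Matsumura1987] Thm. 2.1; [Washington1997] §13.2; [BurungaleCastellaSkinner2025] §2.1, Conj. 4.1.2.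
-/

-- D-0017: single-problem summit, the namespace repeats the problem name by design.
set_option linter.dupNamespace false
set_option autoImplicit false

noncomputable section

open scoped Classical

namespace Summit.BirchSwinnertonDyer.BirchSwinnertonDyer.Theorems.TwoAdicBDPLineLift

open NumberField IsDedekindDomain Literature.NumberTheory.EllipticCurves
  Literature.NumberTheory.EllipticCurves.Rubin1991
  Summit.BirchSwinnertonDyer.BirchSwinnertonDyer.Theorems.SignedBaseChangeAcDivSpecialization.LocalLength

universe u

/-! ## §4 Supplying the finite double layer from ONE line: `M/T₂M` (resp. `M/T₁M`) finitely generated over `ℤ_p` -/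

section LineInput

variable (p : ℕ) [Fact p.Prime]

open PowerSeries Pointwise

/-- **Iterated layers.** For ideals `I, J` and a module `M`: if `(M/JM)/I(M/JM)` is finite then so is
`M/(I + J)M` (the two are isomorphic, `Submodule.quotientQuotientEquivQuotientSup`). [folklore] -/
theorem finite_quotient_sup_smul_top {R : Type*} [CommRing R] {M : Type*} [AddCommGroup M] [Module R M]
    (I J : Ideal R)
    [Finite ((M ⧸ (J • (⊤ : Submodule R M))) ⧸ (I • (⊤ : Submodule R (M ⧸ (J • (⊤ : Submodule R M))))))] :
    Finite (M ⧸ ((I ⊔ J) • (⊤ : Submodule R M))) := by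
  have hmap : (I • (⊤ : Submodule R M)).map (J • (⊤ : Submodule R M)).mkQ =
      I • (⊤ : Submodule R (M ⧸ (J • (⊤ : Submodule R M)))) := by
    rw [Submodule.map_smul'', Submodule.map_top, Submodule.range_mkQ]
  have e := ((Submodule.quotEquivOfEq _ _ hmap).symm.trans
    (Submodule.quotientQuotientEquivQuotientSup (J • (⊤ : Submodule R M)) (I • (⊤ : Submodule R M)))).toEquiv
  rw [Submodule.sup_smul, sup_comm]
  exact Finite.of_equiv _ e

/-- `(p : Λ₂) = C (C p)`. [folklore] -/
theorem natCast_eq_C_C : ((p : ℕ) : IwasawaAlgebra₂ p) = C (C (p : ℤ_[p])) := by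
  rw [map_natCast, map_natCast]

/-- `(c : ℤ_p) • x = C (C c) • x` for a compatible `ℤ_p`-structure on a `Λ₂`-module. [folklore] -/
theorem padicInt_smul_eq_C_C_smul {N : Type*} [AddCommGroup N] [Module (IwasawaAlgebra₂ p) N] [Module ℤ_[p] N]
    [IsScalarTower ℤ_[p] (IwasawaAlgebra₂ p) N] (c : ℤ_[p]) (x : N) :
    c • x = (C (C c) : IwasawaAlgebra₂ p) • x := by
  rw [← smul_one_smul (IwasawaAlgebra₂ p) c x, Algebra.smul_def, mul_one, PowerSeries.algebraMap_apply,
    PowerSeries.algebraMap_apply, Algebra.algebraMap_self_apply]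

/-- **A finite `p`-layer from finite generation over `ℤ_p`.** If a `Λ₂`-module `N` is finitely generated over
`ℤ_p` (for a compatible `ℤ_p`-structure, `IsScalarTower ℤ_[p] Λ₂ N` — e.g. the restricted one,
`Module.compHom N (algebraMap ℤ_[p] Λ₂)`), then `N/pN` is finite: a finitely generated module over the finite ring
`ℤ_p/(p)`. The two-variable reading of the tree's one-variable currency `μ = 0 ⟺ finitely generated over ℤ_p`
(`muInvariant_eq_zero_iff_finite`; proof pattern of `X5.TowerGap.finite_modP_of_moduleFinite_padicInt`).
[cite: Washington1997, §13.2] -/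
theorem finite_quotient_span_p_smul_top_of_moduleFinite_padicInt (N : Type*) [AddCommGroup N]
    [Module (IwasawaAlgebra₂ p) N] [Module ℤ_[p] N] [IsScalarTower ℤ_[p] (IwasawaAlgebra₂ p) N]
    [Module.Finite ℤ_[p] N] :
    Finite (N ⧸ ((Ideal.span {C (C (p : ℤ_[p]))} : Ideal (IwasawaAlgebra₂ p)) •
      (⊤ : Submodule (IwasawaAlgebra₂ p) N))) := by
  set P : Submodule (IwasawaAlgebra₂ p) N :=
    ((Ideal.span {C (C (p : ℤ_[p]))} : Ideal (IwasawaAlgebra₂ p)) • (⊤ : Submodule (IwasawaAlgebra₂ p) N))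
    with hP
  haveI : Module.Finite ℤ_[p] (N ⧸ P) := Module.Finite.quotient ℤ_[p] P
  -- `N/pN` is killed by `p`
  have hQ : ∀ q : N ⧸ P, (p : ℤ_[p]) • q = 0 := fun q => by
    induction q using Submodule.Quotient.induction_on with
    | H x =>
      rw [← Submodule.Quotient.mk_smul, Submodule.Quotient.mk_eq_zero, padicInt_smul_eq_C_C_smul]
      exact Submodule.smul_mem_smul (Ideal.mem_span_singleton_self _) Submodule.mem_top
  -- hence a finitely generated module over the finite ring `ℤ_p/(p)`
  set 𝔞 : Ideal ℤ_[p] := Ideal.span {(p : ℤ_[p])} with h𝔞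
  have hT : Module.IsTorsionBySet ℤ_[p] (N ⧸ P) 𝔞 := by
    rintro q ⟨a, ha⟩
    obtain ⟨c, rfl⟩ := Ideal.mem_span_singleton'.1 ha
    change (c * (p : ℤ_[p])) • q = 0
    rw [mul_smul, hQ, smul_zero]
  letI : Module (ℤ_[p] ⧸ 𝔞) (N ⧸ P) := hT.module
  haveI : IsScalarTower ℤ_[p] (ℤ_[p] ⧸ 𝔞) (N ⧸ P) := hT.isScalarTower
  haveI : Module.Finite (ℤ_[p] ⧸ 𝔞) (N ⧸ P) := Module.Finite.of_restrictScalars_finite ℤ_[p] _ _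
  haveI : Finite (ℤ_[p] ⧸ 𝔞) := by
    have e : ℤ_[p] ⧸ RingHom.ker (PadicInt.toZMod (p := p)) ≃+* ZMod p :=
      RingHom.quotientKerEquivOfSurjective (ZMod.ringHom_surjective PadicInt.toZMod)
    rw [h𝔞, ← PadicInt.maximalIdeal_eq_span_p, ← PadicInt.ker_toZMod]
    exact Finite.of_equiv _ e.toEquiv.symm
  exact Module.finite_of_finite (ℤ_[p] ⧸ 𝔞)

/-- **The finite double layer `M/(p, T₂)M` from ONE line**: if `M/T₂M` is finitely generated over `ℤ_p` (= the line
module is torsion with `μ = 0`, after control), then `M/(p, T₂)M` is finite. The `ℤ_p`-structure is any compatible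
one on `M` (`IsScalarTower ℤ_[p] Λ₂ M`), inherited by the quotient. [cite: Washington1997, §13.2] -/
theorem finite_quotient_p_CX_of_moduleFinite_padicInt (M : Type*) [AddCommGroup M] [Module (IwasawaAlgebra₂ p) M]
    [Module ℤ_[p] M] [IsScalarTower ℤ_[p] (IwasawaAlgebra₂ p) M]
    [Module.Finite ℤ_[p] (M ⧸ ((Ideal.span {C X} : Ideal (IwasawaAlgebra₂ p)) • (⊤ : Submodule (IwasawaAlgebra₂ p) M)))] :
    Finite (M ⧸ ((Ideal.span ({C (C (p : ℤ_[p])), C X} : Set (IwasawaAlgebra₂ p))) •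
      (⊤ : Submodule (IwasawaAlgebra₂ p) M))) := by
  haveI := finite_quotient_span_p_smul_top_of_moduleFinite_padicInt p
    (M ⧸ ((Ideal.span {C X} : Ideal (IwasawaAlgebra₂ p)) • (⊤ : Submodule (IwasawaAlgebra₂ p) M)))
  have h := finite_quotient_sup_smul_top (M := M) (Ideal.span {C (C (p : ℤ_[p]))})
    (Ideal.span {(C X : IwasawaAlgebra₂ p)})
  rwa [← Ideal.span_insert] at h

/-- **The finite double layer `M/(p, T₁)M` from the other line**: if `M/T₁M` is finitely generated over `ℤ_p`, then
`M/(p, T₁)M` is finite. [cite: Washington1997, §13.2] -/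
theorem finite_quotient_p_X_of_moduleFinite_padicInt (M : Type*) [AddCommGroup M] [Module (IwasawaAlgebra₂ p) M]
    [Module ℤ_[p] M] [IsScalarTower ℤ_[p] (IwasawaAlgebra₂ p) M]
    [Module.Finite ℤ_[p] (M ⧸ ((Ideal.span {X} : Ideal (IwasawaAlgebra₂ p)) • (⊤ : Submodule (IwasawaAlgebra₂ p) M)))] :
    Finite (M ⧸ ((Ideal.span ({C (C (p : ℤ_[p])), X} : Set (IwasawaAlgebra₂ p))) •
      (⊤ : Submodule (IwasawaAlgebra₂ p) M))) := by
  haveI := finite_quotient_span_p_smul_top_of_moduleFinite_padicInt p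
    (M ⧸ ((Ideal.span {X} : Ideal (IwasawaAlgebra₂ p)) • (⊤ : Submodule (IwasawaAlgebra₂ p) M)))
  have h := finite_quotient_sup_smul_top (M := M) (Ideal.span {C (C (p : ℤ_[p]))})
    (Ideal.span {(X : IwasawaAlgebra₂ p)})
  rwa [← Ideal.span_insert] at h

/-- **The same in the `RestrictScalars` currency** of the tree's named fact `muInvariant_eq_zero_iff`: if
`M/T₂M`, with scalars restricted along `ℤ_p → Λ₂`, is finitely generated over `ℤ_p`, then `M/(p, T₂)M` is finite.
[cite: Washington1997, §13.2] -/
theorem finite_quotient_p_CX_of_moduleFinite_restrictScalars (M : Type*) [AddCommGroup M]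
    [Module (IwasawaAlgebra₂ p) M]
    (h : Module.Finite ℤ_[p] (RestrictScalars ℤ_[p] (IwasawaAlgebra₂ p)
      (M ⧸ ((Ideal.span {C X} : Ideal (IwasawaAlgebra₂ p)) • (⊤ : Submodule (IwasawaAlgebra₂ p) M))))) :
    Finite (M ⧸ ((Ideal.span ({C (C (p : ℤ_[p])), C X} : Set (IwasawaAlgebra₂ p))) •
      (⊤ : Submodule (IwasawaAlgebra₂ p) M))) := by
  letI : Module ℤ_[p] (M ⧸ ((Ideal.span {C X} : Ideal (IwasawaAlgebra₂ p)) •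
      (⊤ : Submodule (IwasawaAlgebra₂ p) M))) :=
    Module.compHom _ (algebraMap ℤ_[p] (IwasawaAlgebra₂ p))
  haveI : IsScalarTower ℤ_[p] (IwasawaAlgebra₂ p) (M ⧸ ((Ideal.span {C X} : Ideal (IwasawaAlgebra₂ p)) •
      (⊤ : Submodule (IwasawaAlgebra₂ p) M))) := IsScalarTower.of_compHom ℤ_[p] _ _
  haveI : Module.Finite ℤ_[p] (M ⧸ ((Ideal.span {C X} : Ideal (IwasawaAlgebra₂ p)) •
      (⊤ : Submodule (IwasawaAlgebra₂ p) M))) := h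
  haveI := finite_quotient_span_p_smul_top_of_moduleFinite_padicInt p
    (M ⧸ ((Ideal.span {C X} : Ideal (IwasawaAlgebra₂ p)) • (⊤ : Submodule (IwasawaAlgebra₂ p) M)))
  have h' := finite_quotient_sup_smul_top (M := M) (Ideal.span {C (C (p : ℤ_[p]))})
    (Ideal.span {(C X : IwasawaAlgebra₂ p)})
  rwa [← Ideal.span_insert] at h'

variable {M : Type*} [AddCommGroup M] [Module (IwasawaAlgebra₂ p) M] [Module.Finite (IwasawaAlgebra₂ p) M]

/-- **TORSION from one line, `ℤ_p`-currency**: `M` finitely generated over `Λ₂` with `M/T₂M` finitely generated over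
`ℤ_p` ⇒ `M` is `Λ₂`-torsion. [cite: Matsumura1987, Thm. 2.1] [cite: Washington1997, §13.2] -/
theorem isTorsion_of_moduleFinite_padicInt_quotient_CX
    [Module ℤ_[p] M] [IsScalarTower ℤ_[p] (IwasawaAlgebra₂ p) M]
    [Module.Finite ℤ_[p] (M ⧸ ((Ideal.span {C X} : Ideal (IwasawaAlgebra₂ p)) • (⊤ : Submodule (IwasawaAlgebra₂ p) M)))] :
    Module.IsTorsion (IwasawaAlgebra₂ p) M := by
  haveI := finite_quotient_p_CX_of_moduleFinite_padicInt p M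
  exact isTorsion_of_finite_quotient_p_CX p

/-- **`μ_{Λ₂}(M) = 0` from one line, `ℤ_p`-currency**: `M/T₂M` finitely generated over `ℤ_p` ⇒ `M_{(p)} = 0`.
[cite: Washington1997, §13.2] -/
theorem lengthAt_span_p_eq_zero_of_moduleFinite_padicInt_quotient_CX
    [Module ℤ_[p] M] [IsScalarTower ℤ_[p] (IwasawaAlgebra₂ p) M]
    [Module.Finite ℤ_[p] (M ⧸ ((Ideal.span {C X} : Ideal (IwasawaAlgebra₂ p)) • (⊤ : Submodule (IwasawaAlgebra₂ p) M)))] :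
    Module.lengthAt (IwasawaAlgebra₂ p) M ⟨Ideal.span {C (C (p : ℤ_[p]))}, isPrime_span_C_C_p p⟩ = 0 := by
  haveI := finite_quotient_p_CX_of_moduleFinite_padicInt p M
  exact lengthAt_span_p_eq_zero_of_finite_quotient_p_CX p

end LineInput

/-! ## §5 Residual non-vanishing of a characteristic generator -/

section Residual

variable (p : ℕ) [Fact p.Prime]

open PowerSeries

/-- If `p ∤ C₀` in `Λ₂`, some coefficient of `C₀` is a `p`-adic UNIT. [folklore] -/
theorem exists_isUnit_coeff_of_not_dvd {C₀ : IwasawaAlgebra₂ p} (h : ¬ C (C (p : ℤ_[p])) ∣ C₀) :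
    ∃ i j : ℕ, IsUnit (PowerSeries.coeff j (PowerSeries.coeff i C₀)) := by
  by_contra hall
  push Not at hall
  apply h
  -- every coefficient is a non-unit of `ℤ_p`, i.e. divisible by `p`
  have hdvd : ∀ i j : ℕ, (p : ℤ_[p]) ∣ PowerSeries.coeff j (PowerSeries.coeff i C₀) := fun i j => by
    have hmem : PowerSeries.coeff j (PowerSeries.coeff i C₀) ∈ IsLocalRing.maximalIdeal ℤ_[p] :=
      (IsLocalRing.mem_maximalIdeal _).mpr (mem_nonunits_iff.mpr (hall i j))
    rw [PadicInt.maximalIdeal_eq_span_p] at hmem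
    exact Ideal.mem_span_singleton.mp hmem
  choose c hc using hdvd
  refine ⟨PowerSeries.mk fun i => PowerSeries.mk fun j => c i j, ?_⟩
  ext i j
  simp only [PowerSeries.coeff_C_mul, PowerSeries.coeff_mk]
  exact hc i j

/-- **Residual non-vanishing along any coefficient map.** If `p ∤ C₀` in `Λ₂`, then for every ring map
`J : ℤ_p → 𝒪_{ℂ_p}` the image `toUnr₂ J C₀ ∈ 𝒪_{ℂ_p}⟦T₁⟧⟦T₂⟧` is residually non-zero in `𝔽̄_p⟦T₁⟧⟦T₂⟧`
(the currency `red₂ (toUnr₂ 2 J C) ≠ 0` of the O2 line files). [folklore] -/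
theorem map_residue_toUnr₂_ne_zero_of_not_dvd (J : ℤ_[p] →+* PadicComplexInt p) {C₀ : IwasawaAlgebra₂ p}
    (h : ¬ C (C (p : ℤ_[p])) ∣ C₀) :
    PowerSeries.map (PowerSeries.map (IsLocalRing.residue (PadicComplexInt p)))
        (IwasawaAlgebra₂.toUnr₂ p J C₀) ≠ 0 := by
  obtain ⟨i, j, hu⟩ := exists_isUnit_coeff_of_not_dvd p h
  intro h0
  have hc := congrArg (fun F => PowerSeries.coeff j (PowerSeries.coeff i F)) h0
  simp only [PowerSeries.coeff_map, IwasawaAlgebra₂.coeff_coeff_toUnr₂, map_zero] at hc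
  exact ((IsLocalRing.residue_ne_zero_iff_isUnit _).mpr (hu.map J)) hc

variable {M : Type*} [AddCommGroup M] [Module (IwasawaAlgebra₂ p) M] [Module.Finite (IwasawaAlgebra₂ p) M]

/-- **A generator of `ch_{Λ₂}(M)` is prime to `p`** when `M/(p, T₂)M` is finite. [cite: Washington1997, §13.2] -/
theorem not_dvd_of_charIdeal_eq_span_of_finite_quotient_p_CX
    [Finite (M ⧸ ((Ideal.span ({C (C (p : ℤ_[p])), C X} : Set (IwasawaAlgebra₂ p))) •
      (⊤ : Submodule (IwasawaAlgebra₂ p) M)))]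
    {C₀ : IwasawaAlgebra₂ p} (hC : Module.charIdeal (IwasawaAlgebra₂ p) M = Ideal.span {C₀}) :
    ¬ C (C (p : ℤ_[p])) ∣ C₀ := fun hdvd =>
  not_charIdeal_le_span_p_of_finite_quotient_p_CX p (M := M)
    (hC ▸ Ideal.span_singleton_le_span_singleton.mpr hdvd)

/-- **A generator of `ch_{Λ₂}(M)` is prime to `p`** when `M/(p, T₁)M` is finite. [cite: Washington1997, §13.2] -/
theorem not_dvd_of_charIdeal_eq_span_of_finite_quotient_p_X
    [Finite (M ⧸ ((Ideal.span ({C (C (p : ℤ_[p])), X} : Set (IwasawaAlgebra₂ p))) •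
      (⊤ : Submodule (IwasawaAlgebra₂ p) M)))]
    {C₀ : IwasawaAlgebra₂ p} (hC : Module.charIdeal (IwasawaAlgebra₂ p) M = Ideal.span {C₀}) :
    ¬ C (C (p : ℤ_[p])) ∣ C₀ := fun hdvd =>
  not_charIdeal_le_span_p_of_finite_quotient_p_X p (M := M)
    (hC ▸ Ideal.span_singleton_le_span_singleton.mpr hdvd)

/-- **`red(toUnr₂ J C₀) ≠ 0` for a generator `C₀` of `ch_{Λ₂}(M)`** when `M/(p, T₂)M` is finite — the `μ = 0`
conjunct of the residual equality R / RES2 of the O2 lines, from ONE line. [cite: Washington1997, §13.2] -/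
theorem map_residue_toUnr₂_ne_zero_of_charIdeal_eq_span_of_finite_quotient_p_CX
    [Finite (M ⧸ ((Ideal.span ({C (C (p : ℤ_[p])), C X} : Set (IwasawaAlgebra₂ p))) •
      (⊤ : Submodule (IwasawaAlgebra₂ p) M)))]
    (J : ℤ_[p] →+* PadicComplexInt p) {C₀ : IwasawaAlgebra₂ p}
    (hC : Module.charIdeal (IwasawaAlgebra₂ p) M = Ideal.span {C₀}) :
    PowerSeries.map (PowerSeries.map (IsLocalRing.residue (PadicComplexInt p)))
        (IwasawaAlgebra₂.toUnr₂ p J C₀) ≠ 0 :=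
  map_residue_toUnr₂_ne_zero_of_not_dvd p J (not_dvd_of_charIdeal_eq_span_of_finite_quotient_p_CX p hC)

/-- The same along the line `T₁ = 0`. [cite: Washington1997, §13.2] -/
theorem map_residue_toUnr₂_ne_zero_of_charIdeal_eq_span_of_finite_quotient_p_X
    [Finite (M ⧸ ((Ideal.span ({C (C (p : ℤ_[p])), X} : Set (IwasawaAlgebra₂ p))) •
      (⊤ : Submodule (IwasawaAlgebra₂ p) M)))]
    (J : ℤ_[p] →+* PadicComplexInt p) {C₀ : IwasawaAlgebra₂ p}
    (hC : Module.charIdeal (IwasawaAlgebra₂ p) M = Ideal.span {C₀}) :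
    PowerSeries.map (PowerSeries.map (IsLocalRing.residue (PadicComplexInt p)))
        (IwasawaAlgebra₂.toUnr₂ p J C₀) ≠ 0 :=
  map_residue_toUnr₂_ne_zero_of_not_dvd p J (not_dvd_of_charIdeal_eq_span_of_finite_quotient_p_X p hC)

/-- **`red(toUnr₂ J C₀) ≠ 0` for a generator `C₀` of `ch_{Λ₂}(M)`, `ℤ_p`-currency**: `M/T₂M` finitely generated over
`ℤ_p` suffices. [cite: Washington1997, §13.2] -/
theorem map_residue_toUnr₂_ne_zero_of_charIdeal_eq_span_of_moduleFinite_padicInt_quotient_CX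
    [Module ℤ_[p] M] [IsScalarTower ℤ_[p] (IwasawaAlgebra₂ p) M]
    [Module.Finite ℤ_[p] (M ⧸ ((Ideal.span {C X} : Ideal (IwasawaAlgebra₂ p)) • (⊤ : Submodule (IwasawaAlgebra₂ p) M)))]
    (J : ℤ_[p] →+* PadicComplexInt p) {C₀ : IwasawaAlgebra₂ p}
    (hC : Module.charIdeal (IwasawaAlgebra₂ p) M = Ideal.span {C₀}) :
    PowerSeries.map (PowerSeries.map (IsLocalRing.residue (PadicComplexInt p)))
        (IwasawaAlgebra₂.toUnr₂ p J C₀) ≠ 0 := by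
  haveI := finite_quotient_p_CX_of_moduleFinite_padicInt p M
  exact map_residue_toUnr₂_ne_zero_of_charIdeal_eq_span_of_finite_quotient_p_CX p J hC

end Residual

/-! ## §6 The instantiation at `X_Gr(E/K̃_∞)` (the module of O2 / R0T / Rres) -/

section XGr

variable (p : ℕ) [Fact p.Prime] {K : Type u} [Field K] [NumberField K]

open PowerSeries

/-- **The TORSION conjunct of O2 / R0T from one line**: if `X_Gr(E/K̃_∞)` is finitely generated over `Λ_K = Λ₂`
and its double layer `X_Gr/(p, T₂)X_Gr` is finite, then `X_Gr(E/K̃_∞)` is `Λ_K`-torsion — any prime `p`, any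
curve over a number field `K`, any pair of `ℤ_p`-extensions with topological generators, any `v̄`.
[cite: BurungaleCastellaSkinner2025, Conj. 4.1.2 (p. 8 of arXiv:2405.00270v2)] [cite: Matsumura1987, Thm. 2.1] -/
theorem xGr₂_isTorsion_of_finite_quotient_p_CX (W : WeierstrassCurve K) (κ₁ κ₂ : ZpExtension K p)
    (vbar : HeightOneSpectrum (𝓞 K)) (γ₁ γ₂ : Field.absoluteGaloisGroup K)
    [Fact (ZpExtension.IsTopGeneratorPair κ₁ κ₂ γ₁ γ₂)]
    [Module.Finite (IwasawaAlgebra₂ p) (W.XGr₂ p κ₁ κ₂ vbar γ₁ γ₂)]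
    [Finite (W.XGr₂ p κ₁ κ₂ vbar γ₁ γ₂ ⧸
      ((Ideal.span ({C (C (p : ℤ_[p])), C X} : Set (IwasawaAlgebra₂ p))) •
        (⊤ : Submodule (IwasawaAlgebra₂ p) (W.XGr₂ p κ₁ κ₂ vbar γ₁ γ₂))))] :
    Module.IsTorsion (IwasawaAlgebra₂ p) (W.XGr₂ p κ₁ κ₂ vbar γ₁ γ₂) :=
  isTorsion_of_finite_quotient_p_CX p

/-- The same from the other coordinate line `T₁ = 0`.
[cite: BurungaleCastellaSkinner2025, Conj. 4.1.2 (p. 8 of arXiv:2405.00270v2)] [cite: Matsumura1987, Thm. 2.1] -/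
theorem xGr₂_isTorsion_of_finite_quotient_p_X (W : WeierstrassCurve K) (κ₁ κ₂ : ZpExtension K p)
    (vbar : HeightOneSpectrum (𝓞 K)) (γ₁ γ₂ : Field.absoluteGaloisGroup K)
    [Fact (ZpExtension.IsTopGeneratorPair κ₁ κ₂ γ₁ γ₂)]
    [Module.Finite (IwasawaAlgebra₂ p) (W.XGr₂ p κ₁ κ₂ vbar γ₁ γ₂)]
    [Finite (W.XGr₂ p κ₁ κ₂ vbar γ₁ γ₂ ⧸
      ((Ideal.span ({C (C (p : ℤ_[p])), X} : Set (IwasawaAlgebra₂ p))) •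
        (⊤ : Submodule (IwasawaAlgebra₂ p) (W.XGr₂ p κ₁ κ₂ vbar γ₁ γ₂))))] :
    Module.IsTorsion (IwasawaAlgebra₂ p) (W.XGr₂ p κ₁ κ₂ vbar γ₁ γ₂) :=
  isTorsion_of_finite_quotient_p_X p

/-- **The `μ = 0` conjunct of Rres from one line**: under the same hypotheses, every generator `C₀` of
`ch_{Λ_K}(X_Gr(E/K̃_∞))` is residually non-zero along every coefficient map `J : ℤ_p → 𝒪_{ℂ_p}`.
[cite: BurungaleCastellaSkinner2025, Conj. 4.1.2 (p. 8 of arXiv:2405.00270v2)] [cite: Washington1997, §13.2] -/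
theorem xGr₂_map_residue_toUnr₂_ne_zero_of_finite_quotient_p_CX (W : WeierstrassCurve K)
    (κ₁ κ₂ : ZpExtension K p) (vbar : HeightOneSpectrum (𝓞 K)) (γ₁ γ₂ : Field.absoluteGaloisGroup K)
    [Fact (ZpExtension.IsTopGeneratorPair κ₁ κ₂ γ₁ γ₂)]
    [Module.Finite (IwasawaAlgebra₂ p) (W.XGr₂ p κ₁ κ₂ vbar γ₁ γ₂)]
    [Finite (W.XGr₂ p κ₁ κ₂ vbar γ₁ γ₂ ⧸
      ((Ideal.span ({C (C (p : ℤ_[p])), C X} : Set (IwasawaAlgebra₂ p))) •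
        (⊤ : Submodule (IwasawaAlgebra₂ p) (W.XGr₂ p κ₁ κ₂ vbar γ₁ γ₂))))]
    (J : ℤ_[p] →+* PadicComplexInt p) {C₀ : IwasawaAlgebra₂ p}
    (hC : WeierstrassCurve.XGr₂.charIdeal W p κ₁ κ₂ vbar γ₁ γ₂ = Ideal.span {C₀}) :
    PowerSeries.map (PowerSeries.map (IsLocalRing.residue (PadicComplexInt p)))
        (IwasawaAlgebra₂.toUnr₂ p J C₀) ≠ 0 :=
  map_residue_toUnr₂_ne_zero_of_charIdeal_eq_span_of_finite_quotient_p_CX p J hC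

/-- **The TORSION conjunct of O2 / R0T from one line, `ℤ_p`-currency**: `X_Gr(E/K̃_∞)` finitely generated over
`Λ_K` with `X_Gr/T₂X_Gr` finitely generated over `ℤ_p` (⟸ control to the line `T₂ = 0` + torsion and `μ = 0` there)
⇒ `X_Gr(E/K̃_∞)` is `Λ_K`-torsion. [cite: BurungaleCastellaSkinner2025, Conj. 4.1.2 (p. 8 of arXiv:2405.00270v2)]
[cite: Washington1997, §13.2] -/
theorem xGr₂_isTorsion_of_moduleFinite_padicInt_quotient_CX (W : WeierstrassCurve K) (κ₁ κ₂ : ZpExtension K p)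
    (vbar : HeightOneSpectrum (𝓞 K)) (γ₁ γ₂ : Field.absoluteGaloisGroup K)
    [Fact (ZpExtension.IsTopGeneratorPair κ₁ κ₂ γ₁ γ₂)]
    [Module.Finite (IwasawaAlgebra₂ p) (W.XGr₂ p κ₁ κ₂ vbar γ₁ γ₂)]
    [Module ℤ_[p] (W.XGr₂ p κ₁ κ₂ vbar γ₁ γ₂)] [IsScalarTower ℤ_[p] (IwasawaAlgebra₂ p) (W.XGr₂ p κ₁ κ₂ vbar γ₁ γ₂)]
    [Module.Finite ℤ_[p] (W.XGr₂ p κ₁ κ₂ vbar γ₁ γ₂ ⧸ ((Ideal.span {C X} : Ideal (IwasawaAlgebra₂ p)) •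
        (⊤ : Submodule (IwasawaAlgebra₂ p) (W.XGr₂ p κ₁ κ₂ vbar γ₁ γ₂))))] :
    Module.IsTorsion (IwasawaAlgebra₂ p) (W.XGr₂ p κ₁ κ₂ vbar γ₁ γ₂) :=
  isTorsion_of_moduleFinite_padicInt_quotient_CX p

/-- **The `μ = 0` conjunct of Rres from one line, `ℤ_p`-currency**: under the same hypotheses every generator `C₀` of
`ch_{Λ_K}(X_Gr(E/K̃_∞))` is residually non-zero along every coefficient map `J : ℤ_p → 𝒪_{ℂ_p}`.
[cite: BurungaleCastellaSkinner2025, Conj. 4.1.2 (p. 8 of arXiv:2405.00270v2)] [cite: Washington1997, §13.2] -/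
theorem xGr₂_map_residue_toUnr₂_ne_zero_of_moduleFinite_padicInt_quotient_CX (W : WeierstrassCurve K)
    (κ₁ κ₂ : ZpExtension K p) (vbar : HeightOneSpectrum (𝓞 K)) (γ₁ γ₂ : Field.absoluteGaloisGroup K)
    [Fact (ZpExtension.IsTopGeneratorPair κ₁ κ₂ γ₁ γ₂)]
    [Module.Finite (IwasawaAlgebra₂ p) (W.XGr₂ p κ₁ κ₂ vbar γ₁ γ₂)]
    [Module ℤ_[p] (W.XGr₂ p κ₁ κ₂ vbar γ₁ γ₂)] [IsScalarTower ℤ_[p] (IwasawaAlgebra₂ p) (W.XGr₂ p κ₁ κ₂ vbar γ₁ γ₂)]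
    [Module.Finite ℤ_[p] (W.XGr₂ p κ₁ κ₂ vbar γ₁ γ₂ ⧸ ((Ideal.span {C X} : Ideal (IwasawaAlgebra₂ p)) •
        (⊤ : Submodule (IwasawaAlgebra₂ p) (W.XGr₂ p κ₁ κ₂ vbar γ₁ γ₂))))]
    (J : ℤ_[p] →+* PadicComplexInt p) {C₀ : IwasawaAlgebra₂ p}
    (hC : WeierstrassCurve.XGr₂.charIdeal W p κ₁ κ₂ vbar γ₁ γ₂ = Ideal.span {C₀}) :
    PowerSeries.map (PowerSeries.map (IsLocalRing.residue (PadicComplexInt p)))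
        (IwasawaAlgebra₂.toUnr₂ p J C₀) ≠ 0 :=
  map_residue_toUnr₂_ne_zero_of_charIdeal_eq_span_of_moduleFinite_padicInt_quotient_CX p J hC

end XGr

end Summit.BirchSwinnertonDyer.BirchSwinnertonDyer.Theorems.TwoAdicBDPLineLift

end
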